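import Summits.RiemannHypothesis.RiemannHypothesis.Theorems.HandoffDodgerProfileControl
import Summits.RiemannHypothesis.RiemannHypothesis.Theorems.HandoffDodgerCollar
import Summits.RiemannHypothesis.RiemannHypothesis.Theorems.HandoffDodgerCostTheorem
import HarnessLib

/-!
# HANDOFF — the GAIN: the collar overlap of the mollified dodger at lag `2(b+ε) − 2δ` (ATTEMPT-16 Lemma D2/D3, assembled) (rh-explicit, track «HANDOFF», seat prove-2 gen10, ATTEMPT-19 §6)

HONEST FRAMING. Nothing here bears on the truth of RH; this is the elementary lower bound for the collar term of the small-translate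
criterion (`HandoffDodgerCriterion`) for the witness `θ = F₀ ⋆ φ`, `F₀` the dodger `cutoffCosPoly b K (dodgerCoeff b T K)` (`K = N(T)`),
`φ = moll n` the tree's mollifier (radius `ε = 1/(n+1)`, even, non-negative, mass one). Ingredients: `θ` is a real, EVEN Weil test
function supported in `[−(b+ε), b+ε]` (`weilConv_neg_of_even`, `weilConv_eq_zero_of_support`); the profile minorant
`m(σ′) = κ·(c_∞/2b)·Φ(p₁σ′²)` of `HandoffDodgerProfileControl.re_dodger_edge_sub_ge` (monotone, `≥ 0`); the two transfers of
`HandoffDodgerCollar`; and a restriction of the collar integral to its middle quarter (this replaces the `I₀` substitution and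
ATTEMPT-16's Lemma D3: on `[3Y′/8, 5Y′/8]` both factors are `≥ m(3Y′/8)`).
THEOREM (`dodger_collar_ge`): under the hypotheses of `re_dodger_edge_sub_ge`, `κ := 1 − η − 3τ₁ − τ₂ ≥ 0` and `2ε ≤ δ ≤ b`,
with `Y′ := 2δ − 4ε`,

  `(Y′/4)·(κ·(c_∞/2b)·Φ(p₁(3Y′/8)²))² ≤ Re (θ ⋆ θ̃)(2(b+ε) − 2δ)`.

No `sorry`, standard axioms, no definitions.

References: this track (ATTEMPT-16 §5 Lemma D2, D3; ATTEMPT-18 §3 (R-3); ATTEMPT-19 §6).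
-/

set_option linter.dupNamespace false

noncomputable section

open Complex Finset MeasureTheory Set

namespace Summit.RiemannHypothesis.RiemannHypothesis.Theorems.Handoff

open Literature.NumberTheory.LFunctions Literature.NumberTheory.LFunctions.SchoenfeldBound Literature.NumberTheory.LFunctions.WeilContinuous
open scoped Real

/-! ## Symmetry and support of the mollified dodger -/

/-- The cut-off cosine polynomial is even. [folklore] -/
theorem cutoffCosPoly_neg (b : ℝ) (K : ℕ) (a : ℕ → ℝ) (x : ℝ) : cutoffCosPoly b K a (-x) = cutoffCosPoly b K a x := by
  unfold cutoffCosPoly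
  have hmem : (-x ∈ Icc (-b) b) ↔ (x ∈ Icc (-b) b) := by
    simp only [Set.mem_Icc]; constructor <;> rintro ⟨h1, h2⟩ <;> constructor <;> linarith
  by_cases hx : x ∈ Icc (-b) b
  · rw [indicator_of_mem hx, indicator_of_mem (hmem.2 hx)]
    simp only [mul_neg, Real.cos_neg]
  · rw [indicator_of_notMem hx, indicator_of_notMem (fun h => hx (hmem.1 h))]

/-- The convolution of two even functions is even. [folklore] -/
theorem weilConv_neg_of_even {F φ : ℝ → ℂ} (hF : ∀ u, F (-u) = F u) (hφ : ∀ v, φ (-v) = φ v) (x : ℝ) :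
    weilConv F φ (-x) = weilConv F φ x := by
  rw [weilConv_apply, weilConv_apply, ← integral_neg_eq_self (fun u => F u * φ (-x - u)) volume]
  refine integral_congr_ae (Filter.Eventually.of_forall fun u => ?_)
  simp only
  rw [hF, show -x - -u = -(x - u) by ring, hφ]

/-- Support of a convolution: `F = 0` off `[−b, b]` and `φ = 0` off `[−ε, ε]` give `F ⋆ φ = 0` off `[−(b+ε), b+ε]`. [folklore] -/
theorem weilConv_eq_zero_of_support {F φ : ℝ → ℂ} {b ε : ℝ} (hF : ∀ u : ℝ, b < |u| → F u = 0)
    (hφ : ∀ v : ℝ, ε < |v| → φ v = 0) {x : ℝ} (hx : b + ε < |x|) : weilConv F φ x = 0 := by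
  rw [weilConv_apply]
  refine integral_eq_zero_of_ae (Filter.Eventually.of_forall fun u => ?_)
  simp only [Pi.zero_apply]
  rcases lt_or_ge b |u| with hu | hu
  · rw [hF u hu, zero_mul]
  · have : ε < |x - u| := by
      have := abs_sub_abs_le_abs_sub x u
      linarith
    rw [hφ _ this, mul_zero]

/-! ## The collar gain -/

/-- **ATTEMPT-16 Lemma D2/D3 assembled (the GAIN).** See the module docstring. [this track, ATTEMPT-16 §5; ATTEMPT-19 §6] -/
theorem dodger_collar_ge {b T δ : ℝ} (n : ℕ) (hb : 0 < b) (hT : 0 ≤ T) (hK : π * (zetaZeroCount T) / b ≤ T)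
    (hΔ : ∀ t ∈ Set.Icc 0 T, (zetaZeroCount t : ℝ) - ((min ⌊b * t / π⌋₊ (zetaZeroCount T) : ℕ) : ℝ) ≤ 0)
    (hp : 0 < (dodgerPowerSum b T 1).re) (hδb : δ ≤ b) (hεδ : 2 * (bump n).rOut ≤ δ)
    {N₁ N₂ : ℕ} (hN : N₁ ≤ N₂) (hWN : (T ^ 2 + 1 / 4) * N₂ ≤ (dodgerPowerSum b T 1).re / 2)
    {X η lam ρ₁ ρ₂ τ₁ τ₂ : ℝ} (hX : (dodgerPowerSum b T 1).re * (2 * δ) ^ 2 ≤ X)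
    (hη : Real.exp (2 * ((dodgerPowerSum b T 1).re + (zetaZeroCount T : ℝ) * (T + 1 / 2)) * (T ^ 2 + 1 / 4) * (N₁ : ℝ) ^ 2 /
        (dodgerPowerSum b T 1).re ^ 2) - 1 ≤ η)
    (hlam : 2 * ((dodgerPowerSum b T 1).re + (zetaZeroCount T : ℝ) * (T + 1 / 2)) * (T ^ 2 + 1 / 4) * (N₂ : ℝ) /
        (dodgerPowerSum b T 1).re ^ 2 ≤ lam)
    (hρ₁ : Real.exp (3 + lam) * X / (4 * ((N₁ : ℝ) + 1) ^ 3) ≤ ρ₁) (hρ₁1 : ρ₁ < 1)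
    (hρ₂ : Real.exp 2 * (T ^ 2 + 1 / 4) * (2 * δ) ^ 2 / (2 * ((N₂ : ℝ) + 1) ^ 2) ≤ ρ₂) (hρ₂1 : ρ₂ < 1)
    (hτ₁ : ρ₁ ^ (N₁ + 1) / (1 - ρ₁) ≤ τ₁)
    (hτ₂ : Real.exp (((dodgerPowerSum b T 1).re + ((dodgerPowerSum b T 1).re + (zetaZeroCount T : ℝ) * (T + 1 / 2))) /
        (2 * (T ^ 2 + 1 / 4))) * ρ₂ ^ (N₂ + 1) / (1 - ρ₂) ≤ τ₂)
    (hκ : 0 ≤ 1 - η - 3 * τ₁ - τ₂) :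
    (2 * δ - 4 * (bump n).rOut) / 4 *
        ((1 - η - 3 * τ₁ - τ₂) *
          ((1 / (2 * b)) * ((∏ k ∈ Finset.range (zetaZeroCount T), (latticeFreq b (k + 1)) ^ 2) /
            ∏ ρ ∈ zerosBetween 0 T, ‖dodgerNode ρ‖ ^ (2 * (riemannZetaZeroOrder ρ).toNat))) *
          dodgerPhi ((dodgerPowerSum b T 1).re * (3 * (2 * δ - 4 * (bump n).rOut) / 8) ^ 2)) ^ 2 ≤
      (weilConv (weilConv (cutoffCosPoly b (zetaZeroCount T) (dodgerCoeff b T (zetaZeroCount T))) (moll n))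
        (weilReflect (weilConv (cutoffCosPoly b (zetaZeroCount T) (dodgerCoeff b T (zetaZeroCount T))) (moll n)))
        (2 * (b + (bump n).rOut) - 2 * δ)).re := by
  -- names
  set ε := (bump n).rOut with hεdef
  set F₀ := cutoffCosPoly b (zetaZeroCount T) (dodgerCoeff b T (zetaZeroCount T)) with hF₀
  set φ := moll n with hφdef
  set θ := weilConv F₀ φ with hθdef
  set p := (dodgerPowerSum b T 1).re with hpdef
  set cR := (∏ k ∈ Finset.range (zetaZeroCount T), (latticeFreq b (k + 1)) ^ 2) /
      ∏ ρ ∈ zerosBetween 0 T, ‖dodgerNode ρ‖ ^ (2 * (riemannZetaZeroOrder ρ).toNat) with hcR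
  set κ' := (1 - η - 3 * τ₁ - τ₂) * (1 / (2 * b) * cR) with hκ'
  set m : ℝ → ℝ := fun σ => κ' * dodgerPhi (p * σ ^ 2) with hm
  set Y := 2 * δ - 4 * ε with hY
  set A := b + ε with hA
  have hε0 : 0 < ε := by rw [hεdef, bump_rOut]; positivity
  have hY0 : 0 ≤ Y := by rw [hY]; linarith
  have hδ0 : 0 ≤ δ := by linarith
  have hcR0 : 0 < cR := by
    have h1 : 0 < ∏ k ∈ Finset.range (zetaZeroCount T), (latticeFreq b (k + 1)) ^ 2 :=
      Finset.prod_pos fun k _ => by unfold latticeFreq; positivity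
    exact div_pos h1 (prod_norm_dodgerNode_pow_pos T)
  have hκ'0 : 0 ≤ κ' := mul_nonneg hκ (by positivity)
  have hm0 : ∀ σ, 0 ≤ m σ := fun σ => mul_nonneg hκ'0 (dodgerPhi_pos (by positivity)).le
  have hmmono : ∀ {x y : ℝ}, 0 ≤ x → x ≤ y → m x ≤ m y := by
    intro x y hx hxy
    simp only [hm]
    refine mul_le_mul_of_nonneg_left (dodgerPhi_le_dodgerPhi (by positivity) ?_) hκ'0
    exact mul_le_mul_of_nonneg_left (pow_le_pow_left₀ hx hxy 2) hp.le
  -- `F₀`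
  have hFi : Integrable F₀ := integrable_cutoffCosPoly b _ _
  have hFsupp : ∀ u : ℝ, b < |u| → F₀ u = 0 := fun u hu => cutoffCosPoly_eq_zero_of_lt hu
  have hFs : HasCompactSupport F₀ :=
    HasCompactSupport.of_support_subset_isCompact (isCompact_Icc (a := -b) (b := b)) fun t ht => by
      have h : |t| ≤ b := le_of_not_gt fun h' => (Function.mem_support.1 ht) (hFsupp t h')
      exact Set.mem_Icc.2 (abs_le.1 h)
  have hFreal : ∀ u : ℝ, (F₀ u).im = 0 := fun u => im_cutoffCosPoly b _ _ u
  have hFeven : ∀ u : ℝ, F₀ (-u) = F₀ u := fun u => cutoffCosPoly_neg b _ _ u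
  have hFb : ∀ x : ℝ, b < x → F₀ x = 0 := fun x hx => hFsupp x (hx.trans_le (le_abs_self x))
  -- `φ`
  have hφtest : IsWeilTest φ := isWeilTest_moll n
  have hφreal : ∀ v : ℝ, (φ v).im = 0 := fun v => im_moll n v
  have hφ0 : ∀ v : ℝ, 0 ≤ (φ v).re := fun v => by
    obtain ⟨r, hr, e⟩ := moll_eq_ofReal_nonneg n v
    rw [hφdef, e, Complex.ofReal_re]; exact hr
  have hφsupp : ∀ v : ℝ, ε < |v| → φ v = 0 := fun v hv => moll_eq_zero hv.le
  have hφmass : ∫ v, φ v = 1 := integral_moll n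
  have hφi : Integrable φ := hφtest.1.continuous.integrable_of_hasCompactSupport hφtest.2
  have hφeven : ∀ v : ℝ, φ (-v) = φ v := fun v => by
    show moll n (-v) = moll n v
    unfold moll
    rw [ContDiffBump.normed_neg]
  obtain ⟨Cφ, hCφ⟩ := hφtest.1.continuous.bounded_above_of_compact_support hφtest.2
  have hint : ∀ x : ℝ, Integrable fun u : ℝ => F₀ u * φ (x - u) := fun x =>
    hFi.mul_bdd ((hφtest.1.continuous.comp (continuous_const.sub continuous_id)).aestronglyMeasurable)
      (Filter.Eventually.of_forall fun u => hCφ _)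
  -- `θ`
  have hθ : IsWeilTest θ := isWeilTest_weilConv_of_locallyIntegrable hFi.locallyIntegrable hFs hφtest
  have hθreal : ∀ u : ℝ, (θ u).im = 0 := fun u => im_weilConv_of_im_eq_zero hFreal hφreal u
  have hθeven : ∀ u : ℝ, θ (-u) = θ u := fun u => weilConv_neg_of_even hFeven hφeven u
  have hθsupp : ∀ u : ℝ, A < |u| → θ u = 0 := fun u hu => weilConv_eq_zero_of_support hFsupp hφsupp hu
  -- the profile minorant on `[0, 2δ]` (ATTEMPT-16 Lemma D1)
  have hFm : ∀ σ ∈ Icc 0 (2 * δ), m σ ≤ (F₀ (b - σ)).re := fun σ hσ =>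
    re_dodger_edge_sub_ge hb hT hK hΔ hp hδb hN hWN hX hη hlam hρ₁ hρ₁1 hρ₂ hρ₂1 hτ₁ hτ₂ hσ.1 hσ.2
  have hF0 : ∀ σ ∈ Icc 0 (2 * δ), 0 ≤ (F₀ (b - σ)).re := fun σ hσ => (hm0 σ).trans (hFm σ hσ)
  have hmono : MonotoneOn m (Icc 0 (2 * δ)) := fun x hx y _ hxy => hmmono hx.1 hxy
  -- the edge minorant `g` of `θ`
  set g : ℝ → ℝ := (Set.Ici (2 * ε)).indicator fun σ => m (σ - 2 * ε) with hg
  have hg0 : ∀ σ ∈ Icc 0 (2 * δ), 0 ≤ g σ := by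
    intro σ _
    simp only [hg]
    by_cases h : σ ∈ Set.Ici (2 * ε)
    · rw [indicator_of_mem h]; exact hm0 _
    · rw [indicator_of_notMem h]
  have hgle : ∀ σ ∈ Icc 0 (2 * δ), g σ ≤ (θ (A - σ)).re := by
    intro σ hσ
    simp only [hg]
    have ex : A - σ = b + ε - σ := by rw [hA]
    by_cases h : σ ∈ Set.Ici (2 * ε)
    · rw [indicator_of_mem h, ex]
      exact re_weilConv_ge_of_profile hFreal hmono hFm hφreal hφ0 hε0.le hφsupp hφmass hφi (Set.mem_Ici.1 h) hσ.2
        (hint _)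
    · rw [indicator_of_notMem h, ex]
      exact re_weilConv_nonneg_of_profile hFreal hFb hF0 hφreal hφ0 hφsupp hσ.2 (hint _)
  -- integrability of the collar minorant on `[A − 2δ, A]`
  have hgm : Measurable g := by
    simp only [hg]
    refine Measurable.indicator ?_ measurableSet_Ici
    exact (continuous_const.mul (continuous_dodgerPhi.comp (continuous_const.mul ((continuous_id.sub continuous_const).pow 2)))).measurable
  have hgbound : ∀ s ∈ Icc 0 (2 * δ), g s ≤ m (2 * δ) := by
    intro s hs
    simp only [hg]
    by_cases h : s ∈ Set.Ici (2 * ε)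
    · rw [indicator_of_mem h]
      have h' := Set.mem_Ici.1 h
      exact hmmono (by linarith) (by linarith [hs.2])
    · rw [indicator_of_notMem h]; exact hm0 _
  have hgi : IntegrableOn (fun u : ℝ => g (A - u) * g (u - (A - 2 * δ))) (Icc (A - 2 * δ) A) := by
    refine IntegrableOn.of_bound (by rw [Real.volume_Icc]; exact ENNReal.ofReal_lt_top)
      (((hgm.comp (measurable_const.sub measurable_id)).mul
        (hgm.comp (measurable_id.sub measurable_const))).aestronglyMeasurable) (m (2 * δ) * m (2 * δ)) ?_
    rw [ae_restrict_iff' measurableSet_Icc]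
    refine Filter.Eventually.of_forall fun u hu => ?_
    have h1 : A - u ∈ Icc 0 (2 * δ) := ⟨by linarith [hu.2], by linarith [hu.1]⟩
    have h2 : u - (A - 2 * δ) ∈ Icc 0 (2 * δ) := ⟨by linarith [hu.1], by linarith [hu.2]⟩
    rw [Real.norm_eq_abs, abs_mul, abs_of_nonneg (hg0 _ h1), abs_of_nonneg (hg0 _ h2)]
    exact mul_le_mul (hgbound _ h1) (hgbound _ h2) (hg0 _ h2) (hm0 _)
  -- the collar lemma
  have hcollar := collar_ge_of_edge_profile hθ hθreal hθeven hθsupp hg0 hgle hgi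
  -- restrict the collar integral to its middle quarter, where both factors are `≥ m(3Y/8)`
  set s' := Icc (A - 2 * ε - 5 * Y / 8) (A - 2 * ε - 3 * Y / 8) with hs'
  have hsub : s' ⊆ Icc (A - 2 * δ) A := by
    intro u hu
    rw [hs', Set.mem_Icc] at hu
    rw [Set.mem_Icc, hA]
    rw [hA, hY] at hu
    constructor <;> linarith [hu.1, hu.2]
  have hlow : ∀ u ∈ s', m (3 * Y / 8) * m (3 * Y / 8) ≤ g (A - u) * g (u - (A - 2 * δ)) := by
    intro u hu
    rw [hs', Set.mem_Icc, hA, hY] at hu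
    have hmem1 : A - u ∈ Set.Ici (2 * ε) := Set.mem_Ici.2 (by rw [hA]; linarith [hu.2])
    have hmem2 : u - (A - 2 * δ) ∈ Set.Ici (2 * ε) := Set.mem_Ici.2 (by rw [hA]; linarith [hu.1])
    simp only [hg]
    rw [indicator_of_mem hmem1, indicator_of_mem hmem2]
    refine mul_le_mul (hmmono (by linarith) ?_) (hmmono (by linarith) ?_) (hm0 _) (hm0 _)
    · rw [hA, hY]; linarith [hu.2]
    · rw [hA, hY]; linarith [hu.1]
  have hnonneg : 0 ≤ᵐ[volume.restrict (Icc (A - 2 * δ) A)] fun u : ℝ => g (A - u) * g (u - (A - 2 * δ)) := by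
    rw [Filter.EventuallyLE, ae_restrict_iff' measurableSet_Icc]
    refine Filter.Eventually.of_forall fun u hu => ?_
    have h1 : A - u ∈ Icc 0 (2 * δ) := ⟨by linarith [hu.2], by linarith [hu.1]⟩
    have h2 : u - (A - 2 * δ) ∈ Icc 0 (2 * δ) := ⟨by linarith [hu.1], by linarith [hu.2]⟩
    exact mul_nonneg (hg0 _ h1) (hg0 _ h2)
  have hstep1 : ∫ u in s', g (A - u) * g (u - (A - 2 * δ)) ≤ ∫ u in Icc (A - 2 * δ) A, g (A - u) * g (u - (A - 2 * δ)) :=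
    setIntegral_mono_set hgi hnonneg (Filter.Eventually.of_forall hsub)
  have hstep2 : m (3 * Y / 8) * m (3 * Y / 8) * (volume : Measure ℝ).real s' ≤ ∫ u in s', g (A - u) * g (u - (A - 2 * δ)) :=
    setIntegral_ge_of_const_le_real measurableSet_Icc (by rw [hs', Real.volume_Icc]; exact ENNReal.ofReal_ne_top) hlow
      (hgi.mono_set hsub)
  have hvol : (volume : Measure ℝ).real s' = Y / 4 := by
    rw [hs', Real.volume_real_Icc, max_eq_left (by linarith)]
    ring
  rw [hvol] at hstep2
  -- assemble
  have e : (2 * δ - 4 * ε) / 4 * (κ' * dodgerPhi (p * (3 * (2 * δ - 4 * ε) / 8) ^ 2)) ^ 2 =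
      m (3 * Y / 8) * m (3 * Y / 8) * (Y / 4) := by
    simp only [hm, hY]; ring
  rw [e]
  exact hstep2.trans (hstep1.trans hcollar)

/-! ## Merged part: HANDOFF — the DODGER WITNESS at one prime: cost ≤ B < collar ⟹ the zero-sum clause of `SubwindowZeroSumFamily` (rh-explicit, track «HANDOFF», seat prove-2 gen10, ATTEMPT-19 §7)

(Originally a separate file of this track; its module docstring is kept with the HOME copy. Nothing here bears on the truth of RH.) -/

open Literature.NumberTheory.LFunctions.KadiriTail

/-- **The COST BOUND** of `dodger_cost_le` (ATTEMPT-16 Lemma C) as a named function of `b`, the killing height `T`, the shift `δ`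
and the deficit constant `c = 4∫₀ᵀ t·D(t)dt`. [this track, ATTEMPT-16 §4; ATTEMPT-19 §7] -/
def dodgerCostBound (b T δ c : ℝ) : ℝ :=
  2 * (4 * (Real.sinh (δ / 2) ^ 2 + 1) * Real.exp 1 *
        ((∏ k ∈ Finset.range (zetaZeroCount T), (latticeFreq b (k + 1)) ^ 2) /
          ∏ ρ' ∈ zerosBetween 0 T, ‖dodgerNode ρ'‖ ^ (2 * (riemannZetaZeroOrder ρ').toNat)) ^ 2 *
        (4 * Real.cosh (b / 2) ^ 2 * (1 + b) ^ 2 / b ^ 2) *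
      ((zetaZeroCount (2 * T) : ℝ) / T ^ 2 *
          Real.exp (4 * (b / π * (1 + Real.log ((zetaZeroCount T - 1 : ℕ) : ℝ))) - c / (2 * T + 1) ^ 2) +
        Real.exp (144 * (2 * ((zetaZeroCount T - 1 : ℕ) : ℝ)) ^ 2 / (7 * c)) *
          ((zetaZeroCount (Real.sqrt (c / 4)) : ℝ) / (Real.exp 1 * (c / 4)) + tailBound |(0 : ℝ)| (Real.sqrt (c / 4)))))

/-- **The GAIN BOUND** of `dodger_collar_ge` (ATTEMPT-16 Lemma D) as a named function of `b`, `T`, `δ`, the mollifier radius `ε`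
and the profile constant `κ`. [this track, ATTEMPT-16 §5; ATTEMPT-19 §7] -/
def dodgerGainBound (b T δ ε κ : ℝ) : ℝ :=
  (2 * δ - 4 * ε) / 4 *
    (κ * ((1 / (2 * b)) * ((∏ k ∈ Finset.range (zetaZeroCount T), (latticeFreq b (k + 1)) ^ 2) /
        ∏ ρ ∈ zerosBetween 0 T, ‖dodgerNode ρ‖ ^ (2 * (riemannZetaZeroOrder ρ).toNat))) *
      dodgerPhi ((dodgerPowerSum b T 1).re * (3 * (2 * δ - 4 * ε) / 8) ^ 2)) ^ 2

/-- `dodgerGainBound` is non-decreasing in `δ` on `2ε ≤ δ` (for `κ ≥ 0`, `b > 0`, `p₁ ≥ 0`). [this track, ATTEMPT-19 §7] -/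
theorem dodgerGainBound_mono {b T ε κ δ₁ δ₂ : ℝ} (hb : 0 < b) (hκ : 0 ≤ κ) (hp : 0 ≤ (dodgerPowerSum b T 1).re)
    (hε : 2 * ε ≤ δ₁) (h : δ₁ ≤ δ₂) : dodgerGainBound b T δ₁ ε κ ≤ dodgerGainBound b T δ₂ ε κ := by
  unfold dodgerGainBound
  have hc : 0 ≤ (1 / (2 * b)) * ((∏ k ∈ Finset.range (zetaZeroCount T), (latticeFreq b (k + 1)) ^ 2) /
      ∏ ρ ∈ zerosBetween 0 T, ‖dodgerNode ρ‖ ^ (2 * (riemannZetaZeroOrder ρ).toNat)) := by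
    have h1 : 0 < ∏ k ∈ Finset.range (zetaZeroCount T), (latticeFreq b (k + 1)) ^ 2 :=
      Finset.prod_pos fun k _ => by unfold latticeFreq; positivity
    have := prod_norm_dodgerNode_pow_pos T
    positivity
  have hY : 0 ≤ 2 * δ₁ - 4 * ε := by linarith
  have hΦ1 : 0 ≤ dodgerPhi ((dodgerPowerSum b T 1).re * (3 * (2 * δ₁ - 4 * ε) / 8) ^ 2) := (dodgerPhi_pos (by positivity)).le
  have hΦ : dodgerPhi ((dodgerPowerSum b T 1).re * (3 * (2 * δ₁ - 4 * ε) / 8) ^ 2) ≤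
      dodgerPhi ((dodgerPowerSum b T 1).re * (3 * (2 * δ₂ - 4 * ε) / 8) ^ 2) := by
    refine dodgerPhi_le_dodgerPhi (by positivity) (mul_le_mul_of_nonneg_left ?_ hp)
    exact pow_le_pow_left₀ (by linarith) (by linarith) 2
  have hA : 0 ≤ κ * ((1 / (2 * b)) * ((∏ k ∈ Finset.range (zetaZeroCount T), (latticeFreq b (k + 1)) ^ 2) /
      ∏ ρ ∈ zerosBetween 0 T, ‖dodgerNode ρ‖ ^ (2 * (riemannZetaZeroOrder ρ).toNat))) *
      dodgerPhi ((dodgerPowerSum b T 1).re * (3 * (2 * δ₁ - 4 * ε) / 8) ^ 2) := by positivity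
  refine mul_le_mul (by linarith) (pow_le_pow_left₀ hA (mul_le_mul_of_nonneg_left hΦ (mul_nonneg hκ hc)) 2)
    (pow_nonneg hA 2) (by linarith)

/-- The mollified dodger is supported in the closed `q`-subwindow `[−(b+ε), b+ε]`. [this track, ATTEMPT-16 §1] -/
theorem tsupport_dodgerWitness_subset (b T : ℝ) (n : ℕ) :
    tsupport (weilConv (cutoffCosPoly b (zetaZeroCount T) (dodgerCoeff b T (zetaZeroCount T))) (moll n)) ⊆
      Icc (-(b + (bump n).rOut)) (b + (bump n).rOut) := by
  refine closure_minimal (fun x hx => ?_) isClosed_Icc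
  by_contra h
  refine (Function.mem_support.1 hx) (weilConv_eq_zero_of_support (fun u hu => cutoffCosPoly_eq_zero_of_lt hu)
    (fun v hv => moll_eq_zero hv.le) ?_)
  rw [Set.mem_Icc, not_and_or, not_le, not_le] at h
  rcases h with h | h
  · calc b + (bump n).rOut < -x := by linarith
      _ ≤ |x| := neg_le_abs x
  · exact h.trans_le (le_abs_self x)

/-- **THE DODGER WITNESS AT ONE PRIME (ATTEMPT-16 THEOREM 16.1, kernel form).** See the module docstring.
[this track, ATTEMPT-16 §6; ATTEMPT-19 §7] -/
theorem dodger_witness {q q' : ℕ} {b T δ C : ℝ} (n : ℕ)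
    (hbq1 : b + (bump n).rOut ≤ Real.log q / 2) (hbq2 : Real.log q / 2 ≤ b + 2 * (bump n).rOut)
    -- cost hypotheses (`dodger_cost_le`)
    (hb : 0 < b) (hT2 : 2 ≤ T) (hK1 : 1 ≤ zetaZeroCount T) (hK : π * (zetaZeroCount T) / b ≤ T)
    {D : ℝ → ℝ} (hD : ContinuousOn D (Set.Icc 0 T)) (hD0 : ∀ t ∈ Set.Icc 0 T, 0 ≤ D t)
    (hΔ : ∀ t ∈ Set.Icc 0 T, (zetaZeroCount t : ℝ) - ((min ⌊b * t / π⌋₊ (zetaZeroCount T) : ℕ) : ℝ) ≤ -D t)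
    (hc : 64 ≤ 4 * ∫ t in (0 : ℝ)..T, t * D t)
    (hgen : ∀ ρ : ℂ, riemannZeta ρ = 0 → 0 < ρ.im →
      ∀ k ∈ Finset.range (zetaZeroCount T), dodgerNode ρ - latticeFreq b (k + 1) ≠ 0)
    -- gain hypotheses (`dodger_collar_ge`)
    (hp : 0 < (dodgerPowerSum b T 1).re) (hδb : δ ≤ b) (hεδ : 3 * (bump n).rOut ≤ δ)
    {N₁ N₂ : ℕ} (hN : N₁ ≤ N₂) (hWN : (T ^ 2 + 1 / 4) * N₂ ≤ (dodgerPowerSum b T 1).re / 2)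
    {X η lam ρ₁ ρ₂ τ₁ τ₂ : ℝ} (hX : (dodgerPowerSum b T 1).re * (2 * δ) ^ 2 ≤ X)
    (hη : Real.exp (2 * ((dodgerPowerSum b T 1).re + (zetaZeroCount T : ℝ) * (T + 1 / 2)) * (T ^ 2 + 1 / 4) * (N₁ : ℝ) ^ 2 /
        (dodgerPowerSum b T 1).re ^ 2) - 1 ≤ η)
    (hlam : 2 * ((dodgerPowerSum b T 1).re + (zetaZeroCount T : ℝ) * (T + 1 / 2)) * (T ^ 2 + 1 / 4) * (N₂ : ℝ) /
        (dodgerPowerSum b T 1).re ^ 2 ≤ lam)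
    (hρ₁ : Real.exp (3 + lam) * X / (4 * ((N₁ : ℝ) + 1) ^ 3) ≤ ρ₁) (hρ₁1 : ρ₁ < 1)
    (hρ₂ : Real.exp 2 * (T ^ 2 + 1 / 4) * (2 * δ) ^ 2 / (2 * ((N₂ : ℝ) + 1) ^ 2) ≤ ρ₂) (hρ₂1 : ρ₂ < 1)
    (hτ₁ : ρ₁ ^ (N₁ + 1) / (1 - ρ₁) ≤ τ₁)
    (hτ₂ : Real.exp (((dodgerPowerSum b T 1).re + ((dodgerPowerSum b T 1).re + (zetaZeroCount T : ℝ) * (T + 1 / 2))) /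
        (2 * (T ^ 2 + 1 / 4))) * ρ₂ ^ (N₂ + 1) / (1 - ρ₂) ≤ τ₂)
    (hκ : 0 ≤ 1 - η - 3 * τ₁ - τ₂)
    -- the window
    (hδC : δ ≤ C * Real.log q ^ (3 / 2 : ℝ) * (q : ℝ) ^ (-(3 / 2 : ℝ))) (hwin : Real.log q / 2 + δ ≤ Real.log q' / 2)
    -- the one comparison
    (hlt : dodgerCostBound b T δ (4 * ∫ t in (0 : ℝ)..T, t * D t) <
      2 * Real.log q / Real.sqrt q * dodgerGainBound b T (δ - (bump n).rOut) (bump n).rOut (1 - η - 3 * τ₁ - τ₂)) :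
    ∃ θ : ℝ → ℂ, ∃ δ' B : ℝ, IsWeilTest θ ∧ tsupport θ ⊆ Icc (-(Real.log q / 2)) (Real.log q / 2) ∧ 0 ≤ δ' ∧
      δ' ≤ C * Real.log q ^ (3 / 2 : ℝ) * (q : ℝ) ^ (-(3 / 2 : ℝ)) ∧ Real.log q / 2 + δ' ≤ Real.log q' / 2 ∧
      (∀ U : ℝ, ∑ᶠ ρ ∈ weilZeroIndex U,
          (riemannZetaZeroOrder ρ : ℝ) * ‖weilMellin (fun x ↦ θ (x - δ') - θ (x + δ')) ρ‖ ^ 2 ≤ B) ∧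
      B < 2 * Real.log q / Real.sqrt q * (weilConv θ (weilReflect θ) (Real.log q - 2 * δ')).re := by
  set F₀ := cutoffCosPoly b (zetaZeroCount T) (dodgerCoeff b T (zetaZeroCount T)) with hF₀
  set θ := weilConv F₀ (moll n) with hθdef
  set r := (bump n).rOut with hr
  have hr0 : 0 < r := (bump n).rOut_pos
  have hδ0 : 0 ≤ δ := by linarith
  have hFi : Integrable F₀ := integrable_cutoffCosPoly b _ _
  have hFs : HasCompactSupport F₀ :=
    HasCompactSupport.of_support_subset_isCompact (isCompact_Icc (a := -b) (b := b)) fun t ht => by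
      have h : |t| ≤ b := le_of_not_gt fun h' => (Function.mem_support.1 ht) (cutoffCosPoly_eq_zero_of_lt h')
      exact Set.mem_Icc.2 (abs_le.1 h)
  have hθ : IsWeilTest θ := isWeilTest_weilConv_of_locallyIntegrable hFi.locallyIntegrable hFs (isWeilTest_moll n)
  refine ⟨θ, δ, dodgerCostBound b T δ (4 * ∫ t in (0 : ℝ)..T, t * D t), hθ, ?_, hδ0, hδC, hwin, ?_, ?_⟩
  · -- support in the `q`-subwindow
    exact (tsupport_dodgerWitness_subset b T n).trans (Icc_subset_Icc (by linarith) hbq1)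
  · -- the cost (explicit-formula side)
    intro U
    have h := dodger_cost_le hb hT2 hK1 hK hD hD0 hΔ hc hδ0 n hgen U
    exact h
  · -- the gain (collar side), at the shifted collar width `δ_g = δ − ((log q)/2 − b − r) ∈ [δ − r, δ]`
    set δg := δ - (Real.log q / 2 - (b + r)) with hδg
    have hδg1 : δ - r ≤ δg := by rw [hδg]; linarith
    have hδg2 : δg ≤ δ := by rw [hδg]; linarith
    have hδg0 : 0 ≤ δg := by linarith
    have hΔ0 : ∀ t ∈ Set.Icc 0 T, (zetaZeroCount t : ℝ) - ((min ⌊b * t / π⌋₊ (zetaZeroCount T) : ℕ) : ℝ) ≤ 0 :=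
      fun t ht => (hΔ t ht).trans (by linarith [hD0 t ht])
    have hsq : (2 * δg) ^ 2 ≤ (2 * δ) ^ 2 := pow_le_pow_left₀ (by linarith) (by linarith) 2
    have hXg : (dodgerPowerSum b T 1).re * (2 * δg) ^ 2 ≤ X := le_trans (mul_le_mul_of_nonneg_left hsq hp.le) hX
    have hρ₂g : Real.exp 2 * (T ^ 2 + 1 / 4) * (2 * δg) ^ 2 / (2 * ((N₂ : ℝ) + 1) ^ 2) ≤ ρ₂ := by
      refine le_trans ?_ hρ₂
      gcongr
    have hgain := dodger_collar_ge n hb (by linarith) hK hΔ0 hp (hδg2.trans hδb) (by linarith) hN hWN hXg hη hlam hρ₁ hρ₁1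
      hρ₂g hρ₂1 hτ₁ hτ₂ hκ
    have hmono := dodgerGainBound_mono (T := T) (ε := r) (κ := 1 - η - 3 * τ₁ - τ₂) hb hκ hp.le (by linarith) hδg1
    have hlag : Real.log q - 2 * δ = 2 * (b + r) - 2 * δg := by rw [hδg]; ring
    rw [hlag]
    have hlog : 0 ≤ Real.log q := by linarith
    have hfac : 0 ≤ 2 * Real.log q / Real.sqrt q := by positivity
    calc dodgerCostBound b T δ (4 * ∫ t in (0 : ℝ)..T, t * D t)
        < 2 * Real.log q / Real.sqrt q * dodgerGainBound b T (δ - r) r (1 - η - 3 * τ₁ - τ₂) := hlt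
      _ ≤ 2 * Real.log q / Real.sqrt q * dodgerGainBound b T δg r (1 - η - 3 * τ₁ - τ₂) :=
          mul_le_mul_of_nonneg_left hmono hfac
      _ ≤ 2 * Real.log q / Real.sqrt q * (weilConv θ (weilReflect θ) (2 * (b + r) - 2 * δg)).re :=
          mul_le_mul_of_nonneg_left hgain hfac

end Summit.RiemannHypothesis.RiemannHypothesis.Theorems.Handoff

end
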